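import Summits.BirchSwinnertonDyer.BirchSwinnertonDyer.Theorems.TeichmullerTwistDescentTypeLatticeHomologyLevel
import Literature.NumberTheory.ModularSymbols.FullLevelHomologyTransferMaps
import HarnessLib

/-!
# Route `TeichmullerTwistDescent`, crux K `TwistedPeriodLatticeSaturation` (stmt-BirchSwinnertonDyer-25368):
# the homology-level tame-type lattice datum BUILT FROM THE FULL-LEVEL CARRIER `H₁(Y(K(p)K₀(M)), ℤ_p)`

Cell `pub/bsd-wall` (D-0145 line route-BirchSwinnertonDyer-TeichmullerTwistDescent, OPEN rev 7), seat `bsd-line-ttd-p1`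
(prover 1/2, g24).  THEOREMS ONLY (no definition, no named fact, no `sorry`).  BSD is not proved by this file; K is NOT
proved by this file; nothing here closes an item.  `--supports stmt-BirchSwinnertonDyer-25368`.

WHAT.  g22 composed K modulo a «homology-level tame-type lattice datum» (`TypeLatticeHomologyLevel.
not_caseOne_of_homologyLevelDatum`: fields (D1) a `GL₂(𝔽_p)`-stable `ℤ_p`-lattice `Λ'` of finite index in the Bruhat model
`coordRep (ω̃^{p−1−b}) (ω̃ᵇ)`, (D2) its reduction socle, (D3)–(D5) additive maps `βH, βHχ` on `H₁(X₀(N), ℤ)` with four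
properties); g23/g24 built the carrier `Λ_Q(f) = spreadLattice ℤ_p p M f ⊆ Fun(GL₂(𝔽_p), ℤ_p ⊗ Λ_f)` (Hecke-free, `G`-stable),
the coefficient twist `M_θ`, the upstairs twisting operator and the TWIST COMPARISON of the up/down dictionary.  This file
turns those Literature theorems into the datum: for `f ∈ S₂(Γ₀(p²M))`, `χ` the quadratic character mod `p`, an exponent `b`,
and a `ℤ_p`-linear `G`-equivariant map `Ψ : Λ_Q(f) → coordRep (ω̃^{p−1−b}) (ω̃ᵇ)` (this is what the automorphic-type input
(I1) provides), the maps `βH := Ψ ∘ Π_f ∘ lift`, `βHχ := Ψ ∘ Π_f ∘ M_θ ∘ lift` (`θ = ω̃^{(p−1)/2}`) satisfy (D3) `φ(f) = 0 ⇒ βH φ = 0`,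
(D3′) `βH(H) ⊆ (range Ψ)^{T}`, (D4) `(range Ψ)^{T,χ∘det} ⊆ ℤ_p·βHχ(H)`, (D5) `βH(T_χφ) = T_χ^{coord}(βHχ φ)` —
**`exists_homologyLevelDatum_of_carrier`** — MODULO three explicit hypotheses, each a statement about tree objects:
  (H1) `SpreadKernelHyp` («`Π_f` kills invariant classes with zero `f`-period class» = Eisenstein kernel + multiplicity one for `f`),
  (H2) `TwistedSpreadKernelHyp` («`Π_f ∘ M_θ` kills the kernel of the dictionary» = Eisenstein kernel; Knapp's presentation),
  (H3) the dictionary `θ = χ` between the `p`-adic and complex quadratic characters (`MulChar.ofUnitHom θ w = quadInt χ w`).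
Consequently **`not_caseOne_of_carrier`**: with (D1)/(D2) supplied as the finite index of `range Ψ` and the reduction-socle
condition `ReductionSocleLe … (2b)` on it (the weights-in-cohomology input (I3)(I4)), «case one» `g(χ)Λ(f⊗χ) ⊆ pΛ(f)` is
impossible at level `p²M` — so, with the tree's dichotomy, K holds at every instance whose conductor is written `p²M`
(`saturation_at_of_carrier`, binders of `TwistedPeriodLatticeSaturation` verbatim for `D : ModularParametrizationData W (p²M)`).

WHAT IS NOT HERE (hypotheses, named honestly): (H1)–(H3) above; the equivariant `Ψ` with finite-index image and socle
`⊆ {Sym^{2b} ⊗ det^{−b}}` (inputs (I1), (I3)(I4), (I6) of the K-line: automorphic type / weights in cohomology / Kodaira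
exponent — cite-level, for a typer); modularity in the shape the dichotomy uses (`exists_isNewformOf`).
[cite: AshStevens1986, §1 (1.2)–(1.4)] [cite: Stevens1989, Lemma (5.4) p. 97] [cite: EmertonGeeSavitt2015, Lemma 4.1.1]
-/

set_option autoImplicit false
-- single-conjunct summit: `Summit.BirchSwinnertonDyer.BirchSwinnertonDyer.…` repeats the name by design
set_option linter.dupNamespace false

noncomputable section

open scoped Pointwise MatrixGroups TensorProduct

open Function CongruenceSubgroup
open Literature.RepresentationTheory.FiniteGroups Literature.RepresentationTheory.FiniteGroups.GL2
  Literature.NumberTheory.EllipticCurves.ModularForms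
open Literature.NumberTheory.EllipticCurves (Kato2004.teichmullerChar)
open Literature.NumberTheory.ModularSymbols Literature.NumberTheory.ModularSymbols.FullLevel
open Literature.Algebra.Homology

namespace Summit.BirchSwinnertonDyer.BirchSwinnertonDyer.Theorems.TeichmullerTwistDescent.CarrierDatum

open WeierstrassCurve Literature.NumberTheory.EllipticCurves
  Summit.BirchSwinnertonDyer.BirchSwinnertonDyer.Theorems.TeichmullerTwistDescent.TwistedPeriodLatticeDichotomy

variable (p M : ℕ) [hp : Fact p.Prime] [NeZero M] [NeZero (p ^ 2 * M)] (hpM : Nat.Coprime p M)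
  [Fintype (diagTorus (ZMod p))] [Invertible (Fintype.card (diagTorus (ZMod p)) : ℤ_[p])]

omit [NeZero M] [NeZero (p ^ 2 * M)] [Fintype (diagTorus (ZMod p))] [Invertible (Fintype.card (diagTorus (ZMod p)) : ℤ_[p])] in
/-- `θ = ω̃^{(p−1)/2}` is involutive for odd `p`: `θ(u)² = ω̃(u)^{p−1} = 1`. [cite: Lang1990, Ch. 1 §2] -/
theorem teichmullerChar_pow_half_mul_self (hp2 : p ≠ 2) (u : (ZMod p)ˣ) :
    (Kato2004.teichmullerChar p ^ ((p - 1) / 2)) u * (Kato2004.teichmullerChar p ^ ((p - 1) / 2)) u = 1 := by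
  rw [MonoidHom.pow_apply, ← pow_add, ← two_mul, Nat.two_mul_div_two_of_even (hp.out.even_sub_one hp2),
    Literature.NumberTheory.EllipticCurves.Kato2004.teichmullerChar_pow_sub_one]

/-- **The homology-level datum from the carrier** (fields (D3), (D3′), (D4), (D5) of `not_caseOne_of_homologyLevelDatum`
with `Λ'.toSubmodule = range Ψ`), MODULO the two spread-kernel hypotheses and the `θ = χ` dictionary.
[cite: AshStevens1986, §1 (1.2)–(1.4)] [cite: Stevens1989, Lemma (5.4) p. 97] -/
theorem exists_homologyLevelDatum_of_carrier (hp2 : p ≠ 2) (f : CuspForm (Gamma0 (p ^ 2 * M)) 2) (b : ℕ)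
    {χ : DirichletCharacter ℂ p} (hχ : χ.IsQuadratic) (hprim : χ.IsPrimitive)
    (Ψ : spreadLattice ℤ_[p] p M hpM f →ₗ[ℤ_[p]] (Option (ZMod p) → ℤ_[p]))
    (hΨ : IsEquivariantOnSpread ℤ_[p] p M hpM f
      (coordRep (Kato2004.teichmullerChar p ^ (p - 1 - b)) (Kato2004.teichmullerChar p ^ b)) Ψ)
    (hK : SpreadKernelHyp ℤ_[p] p M hpM f)
    (hKχ : TwistedSpreadKernelHyp ℤ_[p] p M hpM f (Kato2004.teichmullerChar p ^ ((p - 1) / 2)))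
    (hθχ : ∀ w : ZMod p, MulChar.ofUnitHom (Kato2004.teichmullerChar p ^ ((p - 1) / 2)) w = (quadInt χ w : ℤ_[p])) :
    ∃ βH βHχ : periodHomology (p ^ 2 * M) →+ (Option (ZMod p) → ℤ_[p]),
      (∀ φ : periodHomology (p ^ 2 * M), (φ : Module.Dual ℂ (CuspForm (Gamma0 (p ^ 2 * M)) 2)) f = 0 → βH φ = 0) ∧
      (∀ φ : periodHomology (p ^ 2 * M), βH φ ∈ LinearMap.range Ψ ⊓
        coordTorusEigenspace (Kato2004.teichmullerChar p ^ (p - 1 - b)) (Kato2004.teichmullerChar p ^ b)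
          (fun _ _ => (1 : ℤ_[p]))) ∧
      (LinearMap.range Ψ ⊓
          coordTorusEigenspace (Kato2004.teichmullerChar p ^ (p - 1 - b)) (Kato2004.teichmullerChar p ^ b)
            (fun a c : (ZMod p)ˣ => MulChar.ofUnitHom (Kato2004.teichmullerChar p ^ ((p - 1) / 2)) (a : ZMod p) *
              MulChar.ofUnitHom (Kato2004.teichmullerChar p ^ ((p - 1) / 2)) (c : ZMod p)) ≤
        Submodule.span ℤ_[p] (Set.range βHχ)) ∧
      (∀ φ ψ : periodHomology (p ^ 2 * M),
        (∀ h : CuspForm (Gamma0 (p ^ 2 * M)) 2, (ψ : Module.Dual ℂ (CuspForm (Gamma0 (p ^ 2 * M)) 2)) h =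
          gaussSum χ (ZMod.stdAddChar (N := p)) *
            (φ : Module.Dual ℂ (CuspForm (Gamma0 (p ^ 2 * M)) 2))
              (charTwist (p ^ 2 * M) dvd_rfl (dvd_mul_right (p ^ 2) M) hχ h)) →
        βH ψ = coordTwistOp (Kato2004.teichmullerChar p ^ (p - 1 - b)) (Kato2004.teichmullerChar p ^ b)
          (MulChar.ofUnitHom (Kato2004.teichmullerChar p ^ ((p - 1) / 2))) (βHχ φ)) := by
  set θ := Kato2004.teichmullerChar p ^ ((p - 1) / 2) with hθdef
  set χ₁ := Kato2004.teichmullerChar p ^ (p - 1 - b) with hχ₁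
  set χ₂ := Kato2004.teichmullerChar p ^ b with hχ₂
  have hθ : ∀ u, θ u * θ u = 1 := teichmullerChar_pow_half_mul_self p hp2
  -- the carrier ↔ `periodHomology` conversions
  let toH : periodHomology (p ^ 2 * M) → periodHomologyHecke (p ^ 2 * M) := fun φ => ⟨φ.1, φ.2⟩
  have toH_add : ∀ φ₁ φ₂, toH (φ₁ + φ₂) = toH φ₁ + toH φ₂ := fun _ _ => rfl
  let βH : periodHomology (p ^ 2 * M) →+ (Option (ZMod p) → ℤ_[p]) :=
    AddMonoidHom.mk' (fun φ => transferW ℤ_[p] p M hpM f Ψ (toH φ)) (fun φ₁ φ₂ => by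
      rw [toH_add, transferW_add ℤ_[p] p M hpM f Ψ hK])
  let βHχ : periodHomology (p ^ 2 * M) →+ (Option (ZMod p) → ℤ_[p]) :=
    AddMonoidHom.mk' (fun φ => transferV ℤ_[p] p M hpM f Ψ θ (toH φ)) (fun φ₁ φ₂ => by
      rw [toH_add, transferV_add ℤ_[p] p M hpM f Ψ θ hKχ])
  have βH_apply : ∀ φ, βH φ = transferW ℤ_[p] p M hpM f Ψ (toH φ) := fun _ => rfl
  have βHχ_apply : ∀ φ, βHχ φ = transferV ℤ_[p] p M hpM f Ψ θ (toH φ) := fun _ => rfl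
  refine ⟨βH, βHχ, fun φ hφ => ?_, fun φ => ⟨?_, ?_⟩, ?_, fun φ ψ hψ => ?_⟩
  · -- (D3) `φ(f) = 0 ⇒ βH φ = 0`
    rw [βH_apply]
    exact transferW_eq_zero_of_apply_eq_zero ℤ_[p] p M hpM f Ψ hK (toH φ) hφ
  · -- `βH φ ∈ range Ψ`
    exact ⟨_, rfl⟩
  · -- `βH φ` is `T`-invariant in the model
    rw [SetLike.mem_coe, mem_coordTorusEigenspace_iff]
    intro a c
    rw [one_smul, βH_apply]
    exact apply_transferW_of_mem_diagTorus ℤ_[p] p M hpM f (coordRep χ₁ χ₂) Ψ hΨ (toH φ) (diagElt_mem_diagTorus p a c)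
  · -- (D4) the `χ∘det`-line of `range Ψ` is spanned by `βHχ(H)`
    rintro v ⟨⟨F, hF⟩, hv⟩
    rw [SetLike.mem_coe] at hv
    have hv' : ∑ t : diagTorus (ZMod p), detChar ℤ_[p] p θ t • coordRep χ₁ χ₂ ((t : GL (Fin 2) (ZMod p))⁻¹) (Ψ F) =
        (Fintype.card (diagTorus (ZMod p)) : ℤ_[p]) • Ψ F := by
      rw [hF]
      simp only [MulChar.ofUnitHom_coe] at hv
      exact modelProj_eq_card_smul ℤ_[p] p χ₁ χ₂ θ hv
    have hmem := card_smul_mem_span_transferV ℤ_[p] p M hpM f (coordRep χ₁ χ₂) Ψ hΨ θ hθ hKχ F hv'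
    rw [hF] at hmem
    have hrange : Set.range (transferV ℤ_[p] p M hpM f Ψ θ) ⊆ Set.range βHχ := by
      rintro _ ⟨φ', rfl⟩
      exact ⟨⟨φ'.1, φ'.2⟩, rfl⟩
    have hv1 : v = ⅟(Fintype.card (diagTorus (ZMod p)) : ℤ_[p]) • ((Fintype.card (diagTorus (ZMod p)) : ℤ_[p]) • v) := by
      rw [smul_smul, invOf_mul_self, one_smul]
    rw [hv1]
    exact Submodule.smul_mem _ _ (Submodule.span_mono hrange hmem)
  · -- (D5) `βH(T_χ φ) = T_χ^{coord}(βHχ φ)`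
    have hψ' : toH ψ = twistDown (p ^ 2 * M) (dvd_mul_right (p ^ 2) M) hχ hprim (toH φ) :=
      (twistDown_eq_of_forall (p ^ 2 * M) (dvd_mul_right (p ^ 2) M) hχ hprim (fun h => hψ h)).symm
    rw [βH_apply, hψ', transferW_twistDown ℤ_[p] p M hpM f (coordRep χ₁ χ₂) Ψ hχ hprim hΨ hK θ hθ hθχ, βHχ_apply,
      coordTwistOp_apply]

/-- **«Case one» is impossible at level `p²M` given the carrier inputs.**  Hypotheses: `p` odd; `0 < b`, `2b < p−1`; a residue
algebra `ℤ_p → k`; an equivariant `Ψ : Λ_Q(f) → coordRep (ω̃^{p−1−b}) (ω̃ᵇ)` whose image has finite index ((I1)) and reduction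
socle `⊆ {Sym^{2b} ⊗ det^{−b}}` ((I3)(I4)(I6), stated for ANY `Λ'` with `Λ'.toSubmodule = range Ψ`); the spread-kernel
hypotheses (H1), (H2) and the dictionary (H3).  Conclusion: `∀ w ∈ Λ(f⊗χ), ∃ z ∈ Λ(f), g(χ)w = pz` is false.
[cite: EmertonGeeSavitt2015, Lemma 4.1.1] [cite: Stevens1989, Lemma (5.4) p. 97] [cite: Lang1990, Ch. 1 §2 Thm. 2.1] -/
theorem not_caseOne_of_carrier (hp2 : p ≠ 2) {k : Type} [Field k] [CharP k p] [Algebra ℤ_[p] k] [Finite k]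
    (hsurj : Surjective (algebraMap ℤ_[p] k))
    (halg : ∀ x : ℤ_[p], algebraMap ℤ_[p] k x = ZMod.castHom (dvd_refl p) k (PadicInt.toZMod x))
    (f : CuspForm (Gamma0 (p ^ 2 * M)) 2) {b : ℕ} (hb : 0 < b) (hb2 : 2 * b < p - 1)
    {χ : DirichletCharacter ℂ p} (hχ : χ.IsQuadratic) (hprim : χ.IsPrimitive)
    (Ψ : spreadLattice ℤ_[p] p M hpM f →ₗ[ℤ_[p]] (Option (ZMod p) → ℤ_[p]))
    (hΨ : IsEquivariantOnSpread ℤ_[p] p M hpM f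
      (coordRep (Kato2004.teichmullerChar p ^ (p - 1 - b)) (Kato2004.teichmullerChar p ^ b)) Ψ)
    {m : ℕ} (hm : ∀ v : Option (ZMod p) → ℤ_[p], (p : ℤ_[p]) ^ m • v ∈ LinearMap.range Ψ)
    (hsoc : ∀ Λ' : Subrepresentation (coordRep (Kato2004.teichmullerChar p ^ (p - 1 - b)) (Kato2004.teichmullerChar p ^ b)),
      Λ'.toSubmodule = LinearMap.range Ψ →
        ReductionSocleLe p k (Kato2004.teichmullerChar p ^ (p - 1 - b)) (Kato2004.teichmullerChar p ^ b) (2 * b) Λ')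
    (hK : SpreadKernelHyp ℤ_[p] p M hpM f)
    (hKχ : TwistedSpreadKernelHyp ℤ_[p] p M hpM f (Kato2004.teichmullerChar p ^ ((p - 1) / 2)))
    (hθχ : ∀ w : ZMod p, MulChar.ofUnitHom (Kato2004.teichmullerChar p ^ ((p - 1) / 2)) w = (quadInt χ w : ℤ_[p]))
    (hcase : ∀ w ∈ periodLattice (charTwist (p ^ 2 * M) dvd_rfl (dvd_mul_right (p ^ 2) M) hχ f), ∃ z ∈ periodLattice f,
      gaussSum χ (ZMod.stdAddChar (N := p)) * w = (p : ℂ) * z) : False := by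
  obtain ⟨βH, βHχ, hker, hβW, hβV, hβ⟩ :=
    exists_homologyLevelDatum_of_carrier p M hpM hp2 f b hχ hprim Ψ hΨ hK hKχ hθχ
  -- the stable lattice `Λ' := range Ψ`
  let Λ' : Subrepresentation (coordRep (Kato2004.teichmullerChar p ^ (p - 1 - b)) (Kato2004.teichmullerChar p ^ b)) :=
    { toSubmodule := LinearMap.range Ψ
      apply_mem_toSubmodule := fun g v hv => by
        obtain ⟨F, rfl⟩ := hv
        exact ⟨⟨funTranslate p g F.1, spreadLattice_translate_mem ℤ_[p] p M hpM f g F.2⟩, hΨ F g⟩ }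
  exact TypeLatticeHomologyLevel.not_caseOne_of_homologyLevelDatum p hp2 hb hb2 hsurj halg Λ' hm (hsoc Λ' rfl)
    (dvd_mul_right (p ^ 2) M) f hχ hprim βH βHχ hker hβW hβV hβ hcase

/-- **K at an instance whose conductor is written `p²M`** (binders of `TwistedPeriodLatticeSaturation` verbatim for
`D : ModularParametrizationData W (p²M)`, `p ≥ 11`, plus `N(W) = p²M`): Modularity + the carrier inputs of
`not_caseOne_of_carrier` give `Λ(f_D) ⊆ g(χ)·Λ(f_D ⊗ χ)`.  The tree's dichotomy (`stub_dichotomy_of_modularity`) leaves K or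
case one; case one is excluded by `not_caseOne_of_carrier`.  BSD is not proved by this; K (for all instances) is not proved
by this — the carrier inputs remain hypotheses. [cite: EdixhovenManin1991, §4] [cite: EmertonGeeSavitt2015, Lemma 4.1.1] -/
theorem saturation_at_of_carrier (hnf : exists_isNewformOf) (W : WeierstrassCurve ℚ) [W.IsElliptic] [W.IsGloballyMinimal]
    (hN : W.conductorNorm ℤ = p ^ 2 * M) (D : ModularParametrizationData W (p ^ 2 * M))
    (hp11 : 11 ≤ p) (hadd : Rank1Residual.Addv W p) (hirr : Rank1Residual.Irr W p)
    (hGo : Summit.BirchSwinnertonDyer.Rank1Residual.Additive.TypeGOrd W p)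
    (hV4 : padicValInt p W.minimalDiscriminantInt ≤ 4)
    (hopt : ∀ z ∈ D.L.lattice, ∃ w ∈ periodLattice D.f, z = D.c * w)
    (χ : DirichletCharacter ℂ p) (hχ : χ.IsQuadratic) (hprim : χ.IsPrimitive)
    {k : Type} [Field k] [CharP k p] [Algebra ℤ_[p] k] [Finite k]
    (hsurj : Surjective (algebraMap ℤ_[p] k))
    (halg : ∀ x : ℤ_[p], algebraMap ℤ_[p] k x = ZMod.castHom (dvd_refl p) k (PadicInt.toZMod x))
    {b : ℕ} (hb : 0 < b) (hb2 : 2 * b < p - 1)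
    (Ψ : spreadLattice ℤ_[p] p M hpM D.f →ₗ[ℤ_[p]] (Option (ZMod p) → ℤ_[p]))
    (hΨ : IsEquivariantOnSpread ℤ_[p] p M hpM D.f
      (coordRep (Kato2004.teichmullerChar p ^ (p - 1 - b)) (Kato2004.teichmullerChar p ^ b)) Ψ)
    {m : ℕ} (hm : ∀ v : Option (ZMod p) → ℤ_[p], (p : ℤ_[p]) ^ m • v ∈ LinearMap.range Ψ)
    (hsoc : ∀ Λ' : Subrepresentation (coordRep (Kato2004.teichmullerChar p ^ (p - 1 - b)) (Kato2004.teichmullerChar p ^ b)),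
      Λ'.toSubmodule = LinearMap.range Ψ →
        ReductionSocleLe p k (Kato2004.teichmullerChar p ^ (p - 1 - b)) (Kato2004.teichmullerChar p ^ b) (2 * b) Λ')
    (hK : SpreadKernelHyp ℤ_[p] p M hpM D.f)
    (hKχ : TwistedSpreadKernelHyp ℤ_[p] p M hpM D.f (Kato2004.teichmullerChar p ^ ((p - 1) / 2)))
    (hθχ : ∀ w : ZMod p, MulChar.ofUnitHom (Kato2004.teichmullerChar p ^ ((p - 1) / 2)) w = (quadInt χ w : ℤ_[p])) :
    ∀ z ∈ periodLattice D.f, ∃ w ∈ periodLattice (charTwist (p ^ 2 * M) (dvd_refl _) (dvd_mul_right (p ^ 2) M) hχ D.f),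
      z = gaussSum χ (ZMod.stdAddChar (N := p)) * w := by
  have hp2 : p ≠ 2 := by omega
  -- transport the dichotomy from level `N(W)` to level `p²M` along `hN`
  have hdich : ∀ (N : ℕ) (hNN : W.conductorNorm ℤ = N) [NeZero N] (D' : ModularParametrizationData W N)
      (hsq : p ^ 2 ∣ N), (∀ z ∈ D'.L.lattice, ∃ w ∈ periodLattice D'.f, z = D'.c * w) →
      (∀ z ∈ periodLattice D'.f, ∃ w ∈ periodLattice (charTwist N (dvd_refl _) hsq hχ D'.f),
          z = gaussSum χ (ZMod.stdAddChar (N := p)) * w) ∨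
      (∀ w ∈ periodLattice (charTwist N (dvd_refl _) hsq hχ D'.f),
          ∃ z ∈ periodLattice D'.f, gaussSum χ (ZMod.stdAddChar (N := p)) * w = (p : ℂ) * z) := by
    intro N hNN
    subst hNN
    intro _ D' hsq hopt'
    exact stub_dichotomy_of_modularity hnf W p D' hsq hp11 hadd hirr hGo hV4 hopt' χ hχ hprim
  rcases hdich (p ^ 2 * M) hN D (dvd_mul_right (p ^ 2) M) hopt with h | hcase
  · exact h
  · exact (not_caseOne_of_carrier p M hpM hp2 hsurj halg D.f hb hb2 hχ hprim Ψ hΨ hm hsoc hK hKχ hθχ hcase).elim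

end Summit.BirchSwinnertonDyer.BirchSwinnertonDyer.Theorems.TeichmullerTwistDescent.CarrierDatum
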